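import Literature.Topology.FourManifolds.TubeIsotopyPushforward
import Literature.Topology.FourManifolds.DiffeotopyProofs
import HarnessLib

/-!
# The handle-slide sweep, planar part II: lifting a planar isotopy to a tube isotopy slice-wise

Topic `Literature/Topology/FourManifolds`; fact seat `provefact-IsStrictHandleSlide.isSurgery`
(R. C. Kirby, *The Topology of 4-Manifolds*, LNM 1374 (1989), Ch. I §4, p. 10 and §5 Thm. 5.1
(1): the slide of an attaching circle over a 2-handle is an isotopy in `Yⱼ = ∂(B⁴ ∪ hⱼ)` across
the meridian disc `Δ` of the new solid torus; in the tree the remaining content is the named fact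
(S) `Literature.Topology.FourManifolds.FramedLink.IsStrictHandleSlide.slideModel`,
`KirbyMovesHandleSlide.lean`). The sweep across `Δ` is built in the surgered tube
`Ψ : S¹ × ℝ² ↪ Yⱼ` (`exists_surgeredTube`, `KirbyMovesSlideTransport.lean`) from a compactly
supported planar isotopy `σ` of a meridian slice (`KirbyMovesSlideSweepPlanar.lean`), spread over
neighbouring slices by a bump `β` on the circle and pushed into `Yⱼ` by
`TubeNbhd.tubeIsotopyPush` (`TubeIsotopyPushforward.lean`). This file provides the middle step,
proved, with no definition and no named fact:

* `Literature.Topology.FourManifolds.SlideSweep.exists_tubeIsotopy_sliceLift` — **slice-wise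
  lift**: for an ambient isotopy `σ` of `ℝ²` all of whose stages are the identity off the disc of
  radius `R`, and a smooth `β : S¹ → ℝ`, there is a compactly supported isotopy `Θ` of the tube
  `S¹ × ℝ²` (`TubeIsotopy`, supporting radius `R`) with stages
  `Θ t (v, p) = (v, σ (t β(v)) p)`. So on the plateau `β = 1` the stage `Θ 1` is `σ 1` in every
  slice, and where `β = 0` it is the identity (Hirsch, *Differential Topology* (1976), Ch. 8 §1,
  p. 178–179: isotopies with compact support in a tube; the jointly smooth inverse family of `σ`
  is the tree's `AmbientIsotopy.exists_diffeotopy_holds`, `DiffeotopyProofs.lean`).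

## References

* R. C. Kirby, *The Topology of 4-Manifolds*, LNM 1374, Springer (1989), Ch. I §4, §5 Thm. 5.1.
  [Kirby1989]
* M. W. Hirsch, *Differential Topology*, GTM 33, Springer (1976), Ch. 8 §1 (pp. 178–179).
  [HirschDT1976]

## Design notes

Theorems only (the lift is packaged as an existence statement with its stages described
pointwise); the model of `S¹ × ℝ²` is written out as `(𝓡 1).prod 𝓘(ℝ, ℝ²)` (the tree's local
notation `I𝕋₁`). No `sorry`.
-/

open scoped Manifold ContDiff Topology
open Function Set Metric

noncomputable section

namespace Literature.Topology.FourManifolds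

namespace SlideSweep

/-- The time profile `(t, v) ↦ t β(v)` composed into `(t, (v, p)) ↦ (t β(v), p)` is smooth, for a
smooth `β` on the circle. [folklore] -/
theorem contMDiff_sliceTime {β : Metric.sphere (0 : EuclideanSpace ℝ (Fin 2)) 1 → ℝ}
    (hβ : ContMDiff (𝓡 1) 𝓘(ℝ, ℝ) ∞ β) :
    ContMDiff (𝓘(ℝ, ℝ).prod ((𝓡 1).prod 𝓘(ℝ, EuclideanSpace ℝ (Fin 2))))
      (𝓘(ℝ, ℝ).prod 𝓘(ℝ, EuclideanSpace ℝ (Fin 2))) ∞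
      fun q : ℝ × ((Metric.sphere (0 : EuclideanSpace ℝ (Fin 2)) 1) × EuclideanSpace ℝ (Fin 2)) ↦
        (q.1 * β q.2.1, q.2.2) := by
  -- `q ↦ (q.1, β q.2.1, q.2.2)` into the vector space `ℝ × ℝ × ℝ²`, then `(t, b, p) ↦ (t b, p)`
  have h1 : ContMDiff (𝓘(ℝ, ℝ).prod ((𝓡 1).prod 𝓘(ℝ, EuclideanSpace ℝ (Fin 2))))
      𝓘(ℝ, ℝ × (ℝ × EuclideanSpace ℝ (Fin 2))) ∞
      fun q : ℝ × ((Metric.sphere (0 : EuclideanSpace ℝ (Fin 2)) 1) × EuclideanSpace ℝ (Fin 2)) ↦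
        (q.1, (β q.2.1, q.2.2)) :=
    contMDiff_fst.prodMk_space
      ((hβ.comp (contMDiff_fst.comp contMDiff_snd)).prodMk_space (contMDiff_snd.comp contMDiff_snd))
  have h2 : ContDiff ℝ ∞ fun q : ℝ × (ℝ × EuclideanSpace ℝ (Fin 2)) ↦ (q.1 * q.2.1, q.2.2) :=
    (contDiff_fst.mul (contDiff_fst.comp contDiff_snd)).prodMk (contDiff_snd.comp contDiff_snd)
  have h3 := h2.contMDiff.comp h1
  rw [← modelWithCornersSelf_prod, ← chartedSpaceSelf_prod] at h3
  exact h3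

/-- **Slice-wise lift of a planar isotopy to the tube.** Let `σ` be an ambient isotopy of `ℝ²`
all of whose stages are the identity off the closed disc of radius `R`, and `β : S¹ → ℝ` smooth.
Then there is a compactly supported isotopy `Θ` of `S¹ × ℝ²` with supporting radius `R` and
stages `Θ t (v, p) = (v, σ (t β(v)) p)`: at time `1` it is `σ 1` in the slices where `β = 1` and
the identity in the slices where `β = 0`. (Write `σ` as a diffeotopy — jointly smooth inverse
family, `AmbientIsotopy.exists_diffeotopy_holds` — and lift both families slice-wise with the
time rescaled by `β`; Hirsch (1976), Ch. 8 §1, pp. 178–179.) [cite: HirschDT1976, Ch. 8 §1] -/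
theorem exists_tubeIsotopy_sliceLift (σ : AmbientIsotopy 𝓘(ℝ, EuclideanSpace ℝ (Fin 2)) (EuclideanSpace ℝ (Fin 2)))
    {R : ℝ} (hR : ∀ t (p : EuclideanSpace ℝ (Fin 2)), R ≤ ‖p‖ → σ.toFun t p = p)
    {β : Metric.sphere (0 : EuclideanSpace ℝ (Fin 2)) 1 → ℝ} (hβ : ContMDiff (𝓡 1) 𝓘(ℝ, ℝ) ∞ β) :
    ∃ Θ : TubeIsotopy, Θ.radius = R ∧
      ∀ (t : ℝ) (v : Metric.sphere (0 : EuclideanSpace ℝ (Fin 2)) 1) (p : EuclideanSpace ℝ (Fin 2)),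
        Θ.toFun t (v, p) = (v, σ.toFun (t * β v) p) := by
  obtain ⟨D, hD⟩ := AmbientIsotopy.exists_diffeotopy_holds σ
  -- the lifted families
  set F : ℝ → (Metric.sphere (0 : EuclideanSpace ℝ (Fin 2)) 1) × EuclideanSpace ℝ (Fin 2) →
      (Metric.sphere (0 : EuclideanSpace ℝ (Fin 2)) 1) × EuclideanSpace ℝ (Fin 2) :=
    fun t q ↦ (q.1, D.toFun (t * β q.1) q.2) with hF
  set G : ℝ → (Metric.sphere (0 : EuclideanSpace ℝ (Fin 2)) 1) × EuclideanSpace ℝ (Fin 2) →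
      (Metric.sphere (0 : EuclideanSpace ℝ (Fin 2)) 1) × EuclideanSpace ℝ (Fin 2) :=
    fun t q ↦ (q.1, D.invFun (t * β q.1) q.2) with hG
  have hFs : ContMDiff (𝓘(ℝ, ℝ).prod ((𝓡 1).prod 𝓘(ℝ, EuclideanSpace ℝ (Fin 2))))
      ((𝓡 1).prod 𝓘(ℝ, EuclideanSpace ℝ (Fin 2))) ∞ (uncurry F) :=
    (contMDiff_fst.comp contMDiff_snd).prodMk
      (D.contMDiff_uncurry_toFun.comp (contMDiff_sliceTime hβ))
  have hGs : ContMDiff (𝓘(ℝ, ℝ).prod ((𝓡 1).prod 𝓘(ℝ, EuclideanSpace ℝ (Fin 2))))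
      ((𝓡 1).prod 𝓘(ℝ, EuclideanSpace ℝ (Fin 2))) ∞ (uncurry G) :=
    (contMDiff_fst.comp contMDiff_snd).prodMk
      (D.contMDiff_uncurry_invFun.comp (contMDiff_sliceTime hβ))
  have hGF : ∀ t q, G t (F t q) = q := fun t q ↦ by
    obtain ⟨v, p⟩ := q
    simp [F, G]
  have hFG : ∀ t q, F t (G t q) = q := fun t q ↦ by
    obtain ⟨v, p⟩ := q
    simp [F, G]
  have h0 : F 0 = id := by
    funext q
    obtain ⟨v, p⟩ := q
    simp [F]
  set Dl := Diffeotopy.mk' ((𝓡 1).prod 𝓘(ℝ, EuclideanSpace ℝ (Fin 2))) F G hFs hGs hGF hFG h0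
    with hDl
  refine ⟨{ toAmbientIsotopy := Dl.toAmbientIsotopy, radius := R, eq_self := ?_ }, rfl, ?_⟩
  · intro t q hq
    obtain ⟨v, p⟩ := q
    change F t (v, p) = (v, p)
    simp only [F]
    rw [hD]
    exact Prod.ext rfl (hR _ p hq)
  · intro t v p
    change F t (v, p) = (v, σ.toFun (t * β v) p)
    simp only [F]
    rw [hD]

/-- **The lift restricted to a slice where `β = 1` is the planar isotopy itself**, and to a
slice where `β = 0` it is the identity (corollary, stated for the stages produced by
`exists_tubeIsotopy_sliceLift`). [folklore] -/
theorem sliceLift_apply_of_eq {σ : AmbientIsotopy 𝓘(ℝ, EuclideanSpace ℝ (Fin 2)) (EuclideanSpace ℝ (Fin 2))}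
    {β : Metric.sphere (0 : EuclideanSpace ℝ (Fin 2)) 1 → ℝ} {Θ : TubeIsotopy}
    (hΘ : ∀ (t : ℝ) (v : Metric.sphere (0 : EuclideanSpace ℝ (Fin 2)) 1) (p : EuclideanSpace ℝ (Fin 2)),
      Θ.toFun t (v, p) = (v, σ.toFun (t * β v) p))
    (t : ℝ) (v : Metric.sphere (0 : EuclideanSpace ℝ (Fin 2)) 1) (p : EuclideanSpace ℝ (Fin 2)) :
    (β v = 1 → Θ.toFun t (v, p) = (v, σ.toFun t p)) ∧ (β v = 0 → Θ.toFun t (v, p) = (v, p)) := by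
  refine ⟨fun h ↦ by rw [hΘ, h, mul_one], fun h ↦ ?_⟩
  rw [hΘ, h, mul_zero, σ.map_zero]
  rfl

end SlideSweep

end Literature.Topology.FourManifolds
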